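import Literature.NumberTheory.EllipticCurves.PAdicLFunctionMinusMultGammaTwist
import Literature.NumberTheory.EllipticCurves.PAdicLFunctionMinusMultDistributionProofs
import Literature.NumberTheory.EllipticCurves.PAdicLFunctionIntegralityAtTwoProofs
import HarnessLib

/-!
# The constant term of the `χ₂`-TWISTED odd branch `L⁻₂(f, α, ω·ψ₋₁, T)` of the one-term minus measure at `p = 2 ∣ N`:
# `∫_{ℤ₂^×} ω(x) (−1)^{ℓ(x)} dμ⁻_{f,α} = α⁻³ · ([1/8]⁻_f + [3/8]⁻_f − [5/8]⁻_f − [7/8]⁻_f)` (proofs only)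

Topic `NumberTheory/EllipticCurves`; namespace `Literature.NumberTheory.EllipticCurves`. THEOREMS ONLY (no
definition, no named fact; D-0014, D-0026). Companion of `PAdicLFunctionMinusMultConstantTermAtTwoProofs` (the untwisted
odd branch: `constantCoeff = α⁻²([1/4]⁻ − [3/4]⁻)`). The object is `padicLFunctionMinusBranchMultTwist f α 1 ε`
(`PAdicLFunctionMinusMultGammaTwist`: `∫ ω(x) ψ(⟨x⟩) (1+T)^{ℓ(x)} dμ⁻`, `ψ(γ) = ε`), at `p = 2` (`e₀ = 2`, `γ = 5`, torsion
`{±1}`) and `ε = −1`, i.e. `ψ = χ₂` the character of the first layer `ℚ(√2)` of `ℚ_∞` — so `ω·ψ = χ₋₄·χ₈ = χ₋₈` on odd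
residues mod `8`:

* `padicLMinusBranchMultTwistRiemannSum_one_neg_one_zero_eq` — **for every level `n ≥ 1`** the Riemann sum of the
  constant term is the FIXED level-`8` sum `Σ_{a ∈ (ℤ/8)ˣ} χ₋₈(a) μ⁻(a + 8ℤ₂) = α⁻³([1/8]⁻ + [3/8]⁻ − [5/8]⁻ − [7/8]⁻)`,
  granted the distribution relation of `μ⁻_{f,α}` (`hdist`): the summand `ξ·(−1)^s·μ⁻(ξ5^s + 2^{n+2}ℤ₂)` is
  `μ⁻(u)·χ₋₈(u mod 8)` at the unit `u = ξ5^s` (`5^s ≡ 1, 5 (mod 8)` as `s` is even, odd), the classes `(ξ, s)`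
  enumerate `(ℤ/2^{n+2})ˣ` (tree `finsum_sum_classes_eq_sum_units`), and the distribution relation pushes the sum down to
  level `8` (tree `sum_units_mul_of_distribution`) — NOT to level `4`: unlike the untwisted branch the weight `(−1)^s` is
  not defined modulo `4`, and the level-`0` Riemann sum is NOT the limit;
* `constantCoeff_padicLFunctionMinusBranchMultTwist_one_neg_one_two` — hence
  `constantCoeff (L⁻₂(f, α, ω·ψ₋₁, T)) = α⁻³([1/8]⁻_f + [3/8]⁻_f − [5/8]⁻_f − [7/8]⁻_f)` (the limit of an eventually
  constant sequence);
* `…_of_coeffField`, `…_of_split` — for a rational newform with `2 ∣ N`, `a₂ = α ≠ 0`, resp. the newform of an elliptic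
  curve SPLIT multiplicative at `2` (`α = 1`): `constantCoeff = [1/8]⁻_f + [3/8]⁻_f − [5/8]⁻_f − [7/8]⁻_f`.

`[1/8]⁻ + [3/8]⁻ − [5/8]⁻ − [7/8]⁻ = Σ_{a mod 8} χ₋₈(a)[a/8]⁻_f` (`χ₋₈ = (−2/·)`) is Birch's twisted symbol sum for the odd
primitive character of conductor `8`; by MTT §I.8 (8.6) it is `τ(χ₋₈)·L(f, χ₋₈, 1)/(Ω⁻_f·i)` — the value of the odd branch at
the character `χ₂` of `Γ`, i.e. the `T = 0` interpolation of its `χ₂`-twist (§I.14 with `ε(2) = 0`). Consumer: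
`Summits/BirchSwinnertonDyer/.../ByReductionTypeAtTwoAdditiveKatoTransportPrintExactAnyImageNonvanishingNegTwo`
(`L⁻₂(f_{W″}, 1, ω·χ₂, T) ≠ 0 ⟸ L(W″ ⊗ χ₋₈, 1) ≠ 0`: the (−2)-split-twist block of the `bsd-2adic` cell's crux C4″ 22618).

References: B. Mazur, J. Tate, J. Teitelbaum, Invent. Math. 84 (1986) §I.4 (4.2), §I.8 (8.6), §I.10 (10.1), §I.11–I.14
[MazurTateTeitelbaum1986Invent]; L. Washington, *Introduction to Cyclotomic Fields* §7.2 [Washington1997].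
-/

noncomputable section

open Filter Topology

open scoped MatrixGroups ModularForm

namespace Literature.NumberTheory.EllipticCurves

open CongruenceSubgroup Literature.NumberTheory.EllipticCurves.ModularForms

variable {N : ℕ} (f : CuspForm (Gamma0 N) 2)

/-- The `2`-adic roots of unity in the torsion of `ℤ₂^×` (`τ = 2`) are `±1`. [folklore] -/
private theorem coe_rootsOfUnity_torsionOrder_two_eq (ξ : rootsOfUnity (torsionOrder 2) ℤ_[2]) :
    ((ξ : ℤ_[2]ˣ) : ℤ_[2]) = 1 ∨ ((ξ : ℤ_[2]ˣ) : ℤ_[2]) = -1 := by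
  obtain ⟨u, hu⟩ := ξ
  have h : u ^ torsionOrder 2 = 1 := (mem_rootsOfUnity _ _).mp hu
  rw [torsionOrder_two] at h
  change (u : ℤ_[2]) = 1 ∨ (u : ℤ_[2]) = -1
  have h' : ((u : ℤ_[2])) ^ 2 = 1 := by
    rw [← Units.val_pow_eq_pow_val, h, Units.val_one]
  exact sq_eq_one_iff.mp h'

/-- `5^k ≡ 1 (mod 8)` for even `k` and `≡ 5 (mod 8)` for odd `k`. [folklore] -/
private theorem five_pow_zmod_eight (k : ℕ) :
    ((cyclotomicGenerator 2 : ℕ) : ZMod (2 ^ 3)) ^ k = if Even k then 1 else 5 := by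
  rw [cyclotomicGenerator_two]
  induction k with
  | zero => simp
  | succ k ih =>
    have hs : ((5 : ℕ) : ZMod (2 ^ 3)) ^ (k + 1) = ((5 : ℕ) : ZMod (2 ^ 3)) ^ k * ((5 : ℕ) : ZMod (2 ^ 3)) :=
      pow_succ _ _
    rw [hs, ih]
    by_cases hk : Even k
    · rw [if_pos hk, if_neg (Nat.not_even_iff_odd.mpr (Even.add_one hk)), one_mul, Nat.cast_ofNat]
    · rw [if_neg hk, if_pos (Nat.not_even_iff_odd.mp hk).add_one, Nat.cast_ofNat]
      decide

/-- Odd residues mod `8` are units (they square to `1`). [folklore] -/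
private theorem isUnit_zmod_eight_of_odd {a : ZMod (2 ^ 3)} (ha : a = 1 ∨ a = 3 ∨ a = 5 ∨ a = 7) : IsUnit a := by
  have key : a * a = 1 := by rcases ha with rfl | rfl | rfl | rfl <;> decide
  exact IsUnit.of_mul_eq_one a key

/-- A sum over `ℤ/8` is the sum of its eight values. [folklore] -/
private theorem sum_univ_zmod_eight {M : Type*} [AddCommMonoid M] (g : ZMod (2 ^ 3) → M) :
    ∑ a, g a = g 0 + g 1 + g 2 + g 3 + g 4 + g 5 + g 6 + g 7 :=
  Fin.sum_univ_eight g

/-- **The Riemann sums of the constant term of the `χ₂`-twisted odd branch at `2` are the FIXED level-`8` sum, for every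
`n ≥ 1`**: `padicLMinusBranchMultTwistRiemannSum f α 1 (−1) 0 n = α⁻³([1/8]⁻ + [3/8]⁻ − [5/8]⁻ − [7/8]⁻)`, granted the
distribution relation of `μ⁻_{f,α}`. The summand `ξ·(−1)^s·μ⁻(ξ5^s + 2^{n+2}ℤ₂)` is `μ⁻(u)·χ₋₈(u mod 8)` at `u = ξ5^s`; the
classes enumerate `(ℤ/2^{n+2})ˣ` (`finsum_sum_classes_eq_sum_units`), and the distribution relation pushes the sum down to
level `8` (`sum_units_mul_of_distribution`). [cite: MazurTateTeitelbaum1986Invent, §I.11–I.13] [cite: Washington1997, §7.2] -/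
theorem padicLMinusBranchMultTwistRiemannSum_one_neg_one_zero_eq {α : ℚ_[2]}
    (hdist : ∀ (n : ℕ) (a : ZMod (2 ^ n)),
      ∑ b ∈ Finset.univ.filter (fun b : ZMod (2 ^ (n + 1)) ↦
        ZMod.castHom (pow_dvd_pow 2 n.le_succ) (ZMod (2 ^ n)) b = a), msdMinusMeasureMult f α (n + 1) b =
        msdMinusMeasureMult f α n a)
    {n : ℕ} (hn : 1 ≤ n) :
    padicLMinusBranchMultTwistRiemannSum f α 1 (-1) 0 n =
      α⁻¹ ^ 3 * ((ratMinusSymbol f (1 / 8) : ℚ_[2]) + (ratMinusSymbol f (3 / 8) : ℚ_[2]) -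
        (ratMinusSymbol f (5 / 8) : ℚ_[2]) - (ratMinusSymbol f (7 / 8) : ℚ_[2])) := by
  classical
  have he : cyclotomicExponent 2 = 2 := cyclotomicExponent_two
  have h3 : 3 ≤ n + cyclotomicExponent 2 := by rw [he]; omega
  -- the weight `χ₋₈` on `ℤ/8` (`1` at `1, 3`, `−1` at `5, 7`, `0` at even residues), as an explicit function
  set w : ZMod (2 ^ 3) → ℚ_[2] := fun a ↦ if a = 1 ∨ a = 3 then 1 else if a = 5 ∨ a = 7 then -1 else 0 with hw
  have hw1 : w 1 = 1 := by rw [hw]; dsimp only; rw [if_pos (Or.inl rfl)]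
  have hw3 : w 3 = 1 := by rw [hw]; dsimp only; rw [if_pos (Or.inr rfl)]
  have hw5 : w 5 = -1 := by rw [hw]; dsimp only; rw [if_neg (by decide), if_pos (Or.inl rfl)]
  have hw7 : w 7 = -1 := by rw [hw]; dsimp only; rw [if_neg (by decide), if_pos (Or.inr rfl)]
  have hw0 : ∀ {a : ZMod (2 ^ 3)}, a = 0 ∨ a = 2 ∨ a = 4 ∨ a = 6 → w a = 0 := by
    intro a ha
    rw [hw]; dsimp only
    rcases ha with rfl | rfl | rfl | rfl <;> (rw [if_neg (by decide), if_neg (by decide)])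
  have hwu : ∀ a : ZMod (2 ^ 3), w a = 0 ∨ IsUnit a := by
    intro a
    by_cases h : a = 1 ∨ a = 3 ∨ a = 5 ∨ a = 7
    · exact Or.inr (isUnit_zmod_eight_of_odd h)
    · left
      rw [hw]; dsimp only
      rw [if_neg (fun h' ↦ h (h'.elim Or.inl fun h3 ↦ Or.inr (Or.inl h3))),
        if_neg (fun h' ↦ h (h'.elim (fun h5 ↦ Or.inr (Or.inr (Or.inl h5))) fun h7 ↦ Or.inr (Or.inr (Or.inr h7))))]
  -- the weight at a class: `χ₋₈(ξ·5^s mod 8) = ξ·(−1)^s`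
  have hclass : ∀ (ξ : rootsOfUnity (torsionOrder 2) ℤ_[2]) (s : ℕ),
      w (PadicInt.toZModPow 3 ((ξ : ℤ_[2]ˣ) : ℤ_[2]) * ((cyclotomicGenerator 2 : ℕ) : ZMod (2 ^ 3)) ^ s) =
        (((ξ : ℤ_[2]ˣ) : ℤ_[2]) : ℚ_[2]) * (-1 : ℚ_[2]) ^ s := by
    intro ξ s
    rw [five_pow_zmod_eight]
    rcases coe_rootsOfUnity_torsionOrder_two_eq ξ with h | h <;> rw [h]
    · simp only [map_one, one_mul, PadicInt.coe_one]
      by_cases hs : Even s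
      · rw [if_pos hs, hw1, hs.neg_one_pow]
      · rw [if_neg hs, hw5, (Nat.not_even_iff_odd.mp hs).neg_one_pow]
    · rw [map_neg, map_one, PadicInt.coe_neg, PadicInt.coe_one]
      by_cases hs : Even s
      · rw [if_pos hs, show (-1 : ZMod (2 ^ 3)) * 1 = 7 by decide, hw7, hs.neg_one_pow, mul_one]
      · rw [if_neg hs, show (-1 : ZMod (2 ^ 3)) * 5 = 3 by decide, hw3,
          (Nat.not_even_iff_odd.mp hs).neg_one_pow, neg_mul, one_mul, neg_neg]
  -- the level-`8` sum
  have hsum8 : ∑ a : (ZMod (2 ^ 3))ˣ, msdMinusMeasureMult f α 3 a * w a =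
      α⁻¹ ^ 3 * ((ratMinusSymbol f (1 / 8) : ℚ_[2]) + (ratMinusSymbol f (3 / 8) : ℚ_[2]) -
        (ratMinusSymbol f (5 / 8) : ℚ_[2]) - (ratMinusSymbol f (7 / 8) : ℚ_[2])) := by
    rw [sum_units_eq_sum_filter_isUnit (F := fun a : ZMod (2 ^ 3) ↦ msdMinusMeasureMult f α 3 a * w a),
      Finset.sum_filter_of_ne (fun a _ hne ↦ (hwu a).resolve_left fun h0 ↦ hne (by rw [h0, mul_zero]))]
    rw [sum_univ_zmod_eight, hw1, hw3, hw5, hw7, hw0 (Or.inl rfl), hw0 (Or.inr (Or.inl rfl)),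
      hw0 (Or.inr (Or.inr (Or.inl rfl))), hw0 (Or.inr (Or.inr (Or.inr rfl)))]
    have hv1 : (1 : ZMod (2 ^ 3)).val = 1 := rfl
    have hv3 : (3 : ZMod (2 ^ 3)).val = 3 := rfl
    have hv5 : (5 : ZMod (2 ^ 3)).val = 5 := rfl
    have hv7 : (7 : ZMod (2 ^ 3)).val = 7 := rfl
    simp only [msdMinusMeasureMult, hv1, hv3, hv5, hv7, mul_zero, zero_add, add_zero, mul_one, mul_neg]
    norm_num
    ring
  -- reindex the Riemann sum over the units of `ℤ/2^{n+2}` and push down to level `8`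
  set G : ZMod (2 ^ (n + cyclotomicExponent 2)) → ℚ_[2] := fun u ↦
    RingHom.id ℚ_[2] (msdMinusMeasureMult f α (n + cyclotomicExponent 2) u) *
      w (ZMod.castHom (pow_dvd_pow 2 h3) (ZMod (2 ^ 3)) u) with hG
  have h1 : padicLMinusBranchMultTwistRiemannSum f α 1 (-1) 0 n =
      ∑ᶠ ζ : rootsOfUnity (torsionOrder 2) ℤ_[2], ∑ s : ZMod (2 ^ n),
        G (PadicInt.toZModPow (n + cyclotomicExponent 2) ((ζ : ℤ_[2]ˣ) : ℤ_[2]) *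
          (cyclotomicGenerator 2 : ZMod (2 ^ (n + cyclotomicExponent 2))) ^ s.val) := by
    unfold padicLMinusBranchMultTwistRiemannSum
    refine finsum_congr fun ζ ↦ Finset.sum_congr rfl fun s _ ↦ ?_
    rw [hG]
    dsimp only
    rw [RingHom.id_apply, Nat.choose_zero_right, Nat.cast_one, mul_one, pow_one, map_mul, map_pow, map_natCast,
      ZMod.castHom_apply, PadicInt.cast_toZModPow _ _ h3, hclass, mul_comm]
  rw [h1, finsum_sum_classes_eq_sum_units 2 n G]
  have h2 := sum_units_mul_of_distribution (μ := msdMinusMeasureMult f α) hdist (RingHom.id ℚ_[2])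
    (by norm_num : 1 ≤ 3) h3 w
  rw [hG]
  dsimp only
  rw [h2]
  simp only [RingHom.id_apply]
  exact hsum8

/-- **The constant term of the `χ₂`-twisted odd branch of the one-term measure at `2`**: granted the distribution relation
of `μ⁻_{f,α}`, `constantCoeff (L⁻₂(f, α, ω·ψ₋₁, T)) = α⁻³ · ([1/8]⁻_f + [3/8]⁻_f − [5/8]⁻_f − [7/8]⁻_f)` — the limit of the
Riemann sums, which are constant from level `1` on. [cite: MazurTateTeitelbaum1986Invent, §I.13–I.14 (ε(p) = 0)] -/
theorem constantCoeff_padicLFunctionMinusBranchMultTwist_one_neg_one_two {α : ℚ_[2]}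
    (hdist : ∀ (n : ℕ) (a : ZMod (2 ^ n)),
      ∑ b ∈ Finset.univ.filter (fun b : ZMod (2 ^ (n + 1)) ↦
        ZMod.castHom (pow_dvd_pow 2 n.le_succ) (ZMod (2 ^ n)) b = a), msdMinusMeasureMult f α (n + 1) b =
        msdMinusMeasureMult f α n a) :
    PowerSeries.constantCoeff (padicLFunctionMinusBranchMultTwist f α 1 (-1)) =
      α⁻¹ ^ 3 * ((ratMinusSymbol f (1 / 8) : ℚ_[2]) + (ratMinusSymbol f (3 / 8) : ℚ_[2]) -
        (ratMinusSymbol f (5 / 8) : ℚ_[2]) - (ratMinusSymbol f (7 / 8) : ℚ_[2])) := by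
  rw [← PowerSeries.coeff_zero_eq_constantCoeff_apply, coeff_padicLFunctionMinusBranchMultTwist,
    padicLMinusBranchMultTwistCoeff]
  exact (tendsto_atTop_of_eventually_const (i₀ := 1) fun n hn ↦
    padicLMinusBranchMultTwistRiemannSum_one_neg_one_zero_eq f hdist hn).limUnder_eq

variable [NeZero N]

/-- **The constant term of the `χ₂`-twisted odd branch at `2` for a RATIONAL NEWFORM** `f` of level `N` with `2 ∣ N`,
`a₂(f) = a₂ ∈ ℤ`, `a₂ ≠ 0` (multiplicative reduction at `2`): `constantCoeff (L⁻₂(f, a₂, ω·ψ₋₁, T)) =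
a₂⁻³([1/8]⁻ + [3/8]⁻ − [5/8]⁻ − [7/8]⁻)`, the distribution relation being the tree's
`sum_fiber_msdMinusMeasureMult_succ_eq_of_coeffField`. [cite: MazurTateTeitelbaum1986Invent, §I.10 (10.1)–(10.2) with ε(p) = 0, §I.13] -/
theorem constantCoeff_padicLFunctionMinusBranchMultTwist_one_neg_one_two_of_coeffField (hf : IsNewform0 f)
    (hQ : coeffField f = ⊥) (h2N : 2 ∣ N) {a₂ : ℤ} (ha₂ : cuspCoeff f 2 = a₂) (ha₀ : (a₂ : ℚ_[2]) ≠ 0) :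
    PowerSeries.constantCoeff (padicLFunctionMinusBranchMultTwist f (a₂ : ℚ_[2]) 1 (-1)) =
      (a₂ : ℚ_[2])⁻¹ ^ 3 * ((ratMinusSymbol f (1 / 8) : ℚ_[2]) + (ratMinusSymbol f (3 / 8) : ℚ_[2]) -
        (ratMinusSymbol f (5 / 8) : ℚ_[2]) - (ratMinusSymbol f (7 / 8) : ℚ_[2])) :=
  constantCoeff_padicLFunctionMinusBranchMultTwist_one_neg_one_two f
    (sum_fiber_msdMinusMeasureMult_succ_eq_of_coeffField (p := 2) hf hQ h2N ha₂ ha₀)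

section Curve

variable {f} {W : WeierstrassCurve ℚ}

/-- **`L⁻₂(f, 1, ω·ψ₋₁, 0) = [1/8]⁻_f + [3/8]⁻_f − [5/8]⁻_f − [7/8]⁻_f` for the newform `f` of an elliptic curve SPLIT
multiplicative at `2`** (`a₂ = 1`, `2 ∣ N`). [cite: MazurTateTeitelbaum1986Invent, §I.10 (10.1) with ε(p) = 0, §I.13–I.14] -/
theorem constantCoeff_padicLFunctionMinusBranchMultTwist_one_neg_one_two_of_split (hf : IsNewformOf W f)
    (hsp : W.HasSplitMultiplicativeReductionAtPrime 2) :
    PowerSeries.constantCoeff (padicLFunctionMinusBranchMultTwist f (1 : ℚ_[2]) 1 (-1)) =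
      (ratMinusSymbol f (1 / 8) : ℚ_[2]) + (ratMinusSymbol f (3 / 8) : ℚ_[2]) -
        (ratMinusSymbol f (5 / 8) : ℚ_[2]) - (ratMinusSymbol f (7 / 8) : ℚ_[2]) := by
  haveI : Fact (Nat.Prime 2) := ⟨Nat.prime_two⟩
  have ha₂ : cuspCoeff f 2 = ((1 : ℤ) : ℂ) := by
    rw [Int.cast_one]; exact (hf.cuspCoeff_eq_one_and_sq_of_split hsp).1
  have h := constantCoeff_padicLFunctionMinusBranchMultTwist_one_neg_one_two_of_coeffField f hf.1 hf.coeffField_eq_bot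
    (hf.dvd_level_of_split hsp) ha₂ (by norm_num)
  rw [Int.cast_one] at h
  rw [h, inv_one, one_pow, one_mul]

end Curve

end Literature.NumberTheory.EllipticCurves

end
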